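import Mathlib
import HarnessLib
import Summits.Ventures.LatticeQCDFlow.Exactness.HaarSU2Gaussian
import Summits.Ventures.LatticeQCDFlow.Exactness.StdGaussianRadial
import Summits.Ventures.LatticeQCDFlow.Exactness.SU2A0Marginal

/-!
# The SU(2) heat-bath law: given `a₀`, the rotation axis is uniform on `S²` and independent of `a₀`

HONEST FRAMING: exact (Metropolis-corrected) sampling algorithms for lattice gauge theory;
figures of merit are autocorrelation/cost numbers at stated couplings and volumes; no
continuum-physics claim.

Venture `LatticeQCDFlow` (cell pub-lqcd), topic `Exactness`, FANOUT row 9 (eng-latcore, the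
engine `latflow.core`).  NEW WORK of the cell, assembling row 9's `HaarSU2Gaussian.lean` (Haar on
SU(2) = law of a normalised Gaussian quaternion), `StdGaussianRadial.lean` / `RadialPolar.lean`
(the direction of a standard Gaussian vector is uniform on the sphere and independent of its
radius), gen-8's `SU2A0Marginal.lean` (the `a₀` marginal of Haar is the semicircle law; the
`a₀`-law of the link weight `e^{c a₀} dHaar`) and Mathlib (`stdGaussian`, product measures,
`measurePreserving_piFinSuccAbove`).  Nothing is cited as a fact.  Printed counterparts, NAMED
ONLY: Creutz 1980 (Phys. Rev. D 21, §III: "the direction of a⃗ is chosen randomly on the unit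
sphere"), Kennedy–Pendleton 1985 (Phys. Lett. B 156), Gattringer–Lang 2010 §4.3.

## What is proved (`SU(2) = Matrix.specialUnitaryGroup (Fin 2) ℂ`, `E3 = EuclideanSpace ℝ (Fin 3)`, `σ = uniformSphere volume` on `sphere 0 1 ⊂ E3`)

* `su2vec U : E3` — the vector part `(x₁, x₂, x₃)` of `U = a₀ + Σ x_k Z_k` (coordinates `su2x genZ_k`
  of `SU2A0Stein.lean`); `su2axis U = dirSphere (su2vec U)` — the rotation AXIS `x⃗/‖x⃗‖`;
  `su2a0_gaussUnit` / `su2vec_gaussUnit` / `su2axis_gaussUnit` — read through the Gaussian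
  quaternion `x`: `a₀ = x₀/‖x‖`, `x⃗ = tail x/‖x‖`, axis `= dirSphere (tail x)`.
* `stdGaussian_map_splitR4` — splitting `ℝ⁴ = ℝ × ℝ³` splits the standard Gaussian into
  `N(0,1) ⊗ N(0, I₃)`; `map_assemble_eq_prod` — Tonelli bookkeeping: a map of the form
  `(t, (s, r)) ↦ (g(t, r), s)` sends `γ ⊗ (σ ⊗ R)` to `(law of g) ⊗ σ`.
* **`map_a0_axis_haar`** — under the Haar probability of SU(2) the pair (`a₀`, axis) has the PRODUCT
  law `semicircleLaw ⊗ σ`: **the axis is uniform on `S²` and independent of `a₀`**.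
* **`map_a0_axis_linkLaw`** — under the one-link law `e^{c a₀(U)} dHaar(U)` (the SU(2) heat-bath
  target with `c = βk`, unnormalised) the pair (`a₀`, axis) has law
  `(√(1−t²)e^{ct}·(2/π) dt) ⊗ σ` — i.e. the Creutz / Kennedy–Pendleton recipe "draw `a₀` from
  A3's density, draw the axis uniformly on `S²`, independently" produces EXACTLY the pair law of the
  heat-bath target.  Together with gen-8's `map_su2a0_linkLaw` this closes the `a₀`/axis part of the
  SU(2) heat-bath dictionary (`TYPED-EXACTNESS-MAP.md`).

NOT CLAIMED: how the engine draws `a₀` (Kennedy–Pendleton rejection loop — `RejectionSampling.lean`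
types the loop, not the Gamma proposal) or the axis (floating point); the reconstruction map
`(a₀, n̂) ↦ a₀ + √(1−a₀²) n̂·Z⃗` as a push-forward identity (left for a sequel); `U = ±1` (axis
undefined, a Haar-null set — handled by a junk value).
-/

namespace Summit.Ventures.LatticeQCDFlow.Exactness

open MeasureTheory Measure Metric Set ProbabilityTheory WithLp Matrix
open scoped ENNReal

/-- `ℝ³` with its Euclidean structure. -/
abbrev E3 := EuclideanSpace ℝ (Fin 3)

/-! ## §1 The vector part and the axis of an SU(2) element -/

section Axis

/-- The vector part `x⃗(U) = (x₁, x₂, x₃)` of `U = a₀ + x₁Z₁ + x₂Z₂ + x₃Z₃`. -/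
noncomputable def su2vec (U : Matrix.specialUnitaryGroup (Fin 2) ℂ) : E3 :=
  toLp 2 ![su2x genZ1 U, su2x genZ2 U, su2x genZ3 U]

/-- The rotation AXIS `x⃗/‖x⃗‖` of an SU(2) element, a point of the unit sphere (junk at `U = ±1`). -/
noncomputable def su2axis (U : Matrix.specialUnitaryGroup (Fin 2) ℂ) : sphere (0 : E3) 1 :=
  dirSphere (su2vec U)

/-- The last three coordinates of `x ∈ ℝ⁴`. -/
noncomputable def tailR4 (x : R4) : E3 := toLp 2 (fun j : Fin 3 => x j.succ)

/-- Coordinates of the tail. -/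
@[simp] theorem tailR4_apply (x : R4) (j : Fin 3) : tailR4 x j = x j.succ := rfl

/-- The tail is linear (scalar part). -/
theorem tailR4_smul (c : ℝ) (x : R4) : tailR4 (c • x) = c • tailR4 x := by
  ext j; simp

/-- `a₀`, read through quaternion coordinates: `a₀(quatVec z) = z₀`. -/
theorem re_trace_quatVec (z : R4) : ((quatVec z).trace).re = 2 * z 0 := by
  rw [Matrix.trace_fin_two, quatVec_apply_00, quatVec_apply_11]
  simp
  ring

/-- The generator coordinates, read through quaternion coordinates. -/
theorem re_trace_genZ_mul_quatVec (z : R4) :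
    ((genZ1 * quatVec z).trace).re = -2 * z 1 ∧ ((genZ2 * quatVec z).trace).re = -2 * z 2 ∧
      ((genZ3 * quatVec z).trace).re = -2 * z 3 := by
  refine ⟨?_, ?_, ?_⟩ <;>
  · rw [Matrix.trace_fin_two, Matrix.mul_apply, Matrix.mul_apply, Fin.sum_univ_two, Fin.sum_univ_two]
    simp [genZ1, genZ2, genZ3, quatVec, quatOf]
    try ring

/-- `a₀` of the Gaussian quaternion: `a₀(gaussUnit x) = x₀/‖x‖` (`x ≠ 0`). -/
theorem su2a0_gaussUnit {x : R4} (hx : x ≠ 0) : su2a0 (gaussUnit x) = ‖x‖⁻¹ * x 0 := by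
  rw [su2a0, coe_gaussUnit_of_ne_zero hx, re_trace_quatVec]
  simp

/-- The vector part of the Gaussian quaternion: `x⃗(gaussUnit x) = tail x/‖x‖` (`x ≠ 0`). -/
theorem su2vec_gaussUnit {x : R4} (hx : x ≠ 0) : su2vec (gaussUnit x) = ‖x‖⁻¹ • tailR4 x := by
  obtain ⟨h1, h2, h3⟩ := re_trace_genZ_mul_quatVec (‖x‖⁻¹ • x)
  have hU : (gaussUnit x : Matrix (Fin 2) (Fin 2) ℂ) = quatVec (‖x‖⁻¹ • x) := coe_gaussUnit_of_ne_zero hx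
  have e1 : su2x genZ1 (gaussUnit x) = ‖x‖⁻¹ * x 1 := by
    unfold su2x; rw [hU, h1]; simp
  have e2 : su2x genZ2 (gaussUnit x) = ‖x‖⁻¹ * x 2 := by
    unfold su2x; rw [hU, h2]; simp
  have e3 : su2x genZ3 (gaussUnit x) = ‖x‖⁻¹ * x 3 := by
    unfold su2x; rw [hU, h3]; simp
  ext j
  fin_cases j <;> simp [su2vec, e1, e2, e3]

/-- The axis of the Gaussian quaternion is the direction of its tail (`x ≠ 0`). -/
theorem su2axis_gaussUnit {x : R4} (hx : x ≠ 0) : su2axis (gaussUnit x) = dirSphere (tailR4 x) := by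
  rw [su2axis, su2vec_gaussUnit hx, dirSphere_smul (inv_pos.2 (norm_pos_iff.2 hx))]

/-- `‖x‖² = x₀² + ‖tail x‖²`. -/
theorem norm_sq_eq_add_tail (x : R4) : ‖x‖ ^ 2 = x 0 ^ 2 + ‖tailR4 x‖ ^ 2 := by
  rw [EuclideanSpace.real_norm_sq_eq, EuclideanSpace.real_norm_sq_eq, Fin.sum_univ_succ]
  simp

/-- `su2vec` is measurable (continuous). -/
theorem measurable_su2vec : Measurable su2vec := by
  refine (measurable_toLp 2 _).comp (measurable_pi_lambda _ fun j => ?_)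
  have h : ∀ Z : Matrix (Fin 2) (Fin 2) ℂ, Continuous fun U : Matrix.specialUnitaryGroup (Fin 2) ℂ =>
      su2x Z U := fun Z => by
    unfold su2x
    refine ((Complex.continuous_re.comp ?_).neg).div_const _
    exact (continuous_id.matrix_trace).comp ((continuous_const.matrix_mul continuous_subtype_val))
  fin_cases j <;> simpa using (h _).measurable

/-- `su2axis` is measurable. -/
theorem measurable_su2axis : Measurable su2axis := measurable_dirSphere.comp measurable_su2vec

/-- The pair (`a₀`, axis) is measurable. -/
theorem measurable_a0_axis : Measurable fun U : Matrix.specialUnitaryGroup (Fin 2) ℂ => (su2a0 U, su2axis U) :=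
  continuous_su2a0.measurable.prodMk measurable_su2axis

end Axis

/-! ## §2 Splitting `ℝ⁴ = ℝ × ℝ³` under the standard Gaussian -/

section Split

/-- `x ↦ (x₀, tail x)`. -/
noncomputable def splitR4 (x : R4) : ℝ × E3 := (x 0, tailR4 x)

/-- `splitR4` is measurable. -/
theorem measurable_splitR4 : Measurable splitR4 :=
  ((measurable_pi_apply 0).comp (measurable_ofLp 2 _)).prodMk
    ((measurable_toLp 2 _).comp (measurable_pi_lambda _ fun _ =>
      (measurable_pi_apply _).comp (measurable_ofLp 2 _)))

/-- `splitR4` in the coordinates of `Fin 4 → ℝ`: remove coordinate `0`, then pass to `E3`. -/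
theorem splitR4_comp_toLp : splitR4 ∘ (toLp 2 : (Fin 4 → ℝ) → R4) =
    Prod.map id (toLp 2 : (Fin 3 → ℝ) → E3) ∘ MeasurableEquiv.piFinSuccAbove (fun _ : Fin 4 => ℝ) 0 := by
  funext x
  refine Prod.ext rfl ?_
  ext j
  simp [splitR4, tailR4, MeasurableEquiv.piFinSuccAbove, Fin.tail]

/-- **Splitting the Gaussian**: `(x₀, tail x)` under `N(0, I₄)` has law `N(0,1) ⊗ N(0, I₃)`. -/
theorem stdGaussian_map_splitR4 :
    (stdGaussian R4).map splitR4 = (gaussianReal 0 1).prod (stdGaussian E3) := by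
  have htoLp3 : Measurable (toLp 2 : (Fin 3 → ℝ) → E3) := measurable_toLp 2 _
  rw [← map_pi_eq_stdGaussian, Measure.map_map measurable_splitR4 (measurable_toLp 2 _), splitR4_comp_toLp,
    ← Measure.map_map (measurable_id.prodMap htoLp3) (MeasurableEquiv.measurable _),
    (measurePreserving_piFinSuccAbove (fun _ : Fin 4 => gaussianReal 0 1) 0).map_eq,
    ← Measure.map_prod_map _ _ measurable_id htoLp3, Measure.map_id, map_pi_eq_stdGaussian]

end Split

/-! ## §3 Tonelli bookkeeping: `(t, (s, r)) ↦ (g(t,r), s)` -/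

section Assemble

variable {S : Type*} [MeasurableSpace S]

/-- For `γ ⊗ (σ ⊗ R)` and a measurable `g : ℝ × ℝ → ℝ`, the map `(t, (s, r)) ↦ (g(t, r), s)` has law
`((γ ⊗ R).map g) ⊗ σ` — the `s`-coordinate stays independent and keeps its law. -/
theorem map_assemble_eq_prod (γ R : Measure ℝ) (σ : Measure S) [IsFiniteMeasure γ] [IsFiniteMeasure R]
    [IsFiniteMeasure σ] {g : ℝ × ℝ → ℝ} (hg : Measurable g) :
    (γ.prod (σ.prod R)).map (fun p : ℝ × (S × ℝ) => (g (p.1, p.2.2), p.2.1)) =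
      ((γ.prod R).map g).prod σ := by
  have hH : Measurable fun p : ℝ × (S × ℝ) => (g (p.1, p.2.2), p.2.1) :=
    (hg.comp (measurable_fst.prodMk (measurable_snd.comp measurable_snd))).prodMk
      (measurable_fst.comp measurable_snd)
  symm
  refine Measure.prod_eq fun A B hA hB => ?_
  rw [Measure.map_apply hH (hA.prod hB), Measure.prod_apply (hH (hA.prod hB)),
    Measure.map_apply hg hA, Measure.prod_apply (hg hA)]
  have hsec : ∀ t : ℝ, Prod.mk t ⁻¹' ((fun p : ℝ × (S × ℝ) => (g (p.1, p.2.2), p.2.1)) ⁻¹' A ×ˢ B) =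
      B ×ˢ (Prod.mk t ⁻¹' (g ⁻¹' A)) := fun t => by
    ext ⟨s, r⟩
    simp [and_comm]
  simp_rw [hsec, Measure.prod_prod]
  rw [lintegral_const_mul _ (measurable_measure_prodMk_left (hg hA)), mul_comm]

end Assemble

/-! ## §4 The law of (`a₀`, axis) under Haar and under the link law -/

section Law

/-- `a₀` and the axis of the Gaussian quaternion, in split coordinates (off the origin). -/
theorem a0_axis_gaussUnit {x : R4} (hx : x ≠ 0) :
    (su2a0 (gaussUnit x), su2axis (gaussUnit x)) =
      (fun p : ℝ × (sphere (0 : E3) 1 × ℝ) => (p.1 / Real.sqrt (p.1 ^ 2 + p.2.2 ^ 2), p.2.1))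
        (Prod.map id (fun y : E3 => (dirSphere y, ‖y‖)) (splitR4 x)) := by
  simp only [Prod.map, id, splitR4, su2axis_gaussUnit hx, su2a0_gaussUnit hx]
  refine Prod.ext ?_ rfl
  simp only
  rw [← norm_sq_eq_add_tail, Real.sqrt_sq (norm_nonneg x), div_eq_inv_mul]

/-- **The SU(2) heat-bath axis law under Haar.**  Under the Haar probability of SU(2) the pair
(`a₀`, axis) is distributed as `semicircleLaw ⊗ uniformSphere`: the axis is uniform on `S²` and
independent of `a₀`. -/
theorem map_a0_axis_haar :
    (Literature.MathematicalPhysics.QuantumFieldTheory.haarProbability (Matrix.specialUnitaryGroup (Fin 2) ℂ)).map (fun U => (su2a0 U, su2axis U)) =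
      semicircleLaw.prod (uniformSphere (volume : Measure E3)) := by
  have hg : Measurable fun q : ℝ × ℝ => q.1 / Real.sqrt (q.1 ^ 2 + q.2 ^ 2) :=
    measurable_fst.div ((measurable_fst.pow_const 2).add (measurable_snd.pow_const 2)).sqrt
  have hT : Measurable (Prod.map id (fun y : E3 => (dirSphere y, ‖y‖)) : ℝ × E3 → ℝ × (sphere (0 : E3) 1 × ℝ)) :=
    measurable_id.prodMap measurable_dirSphere_norm
  have hH : Measurable fun p : ℝ × (sphere (0 : E3) 1 × ℝ) => (p.1 / Real.sqrt (p.1 ^ 2 + p.2.2 ^ 2), p.2.1) :=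
    (hg.comp (measurable_fst.prodMk (measurable_snd.comp measurable_snd))).prodMk
      (measurable_fst.comp measurable_snd)
  -- Step 1: pass to the Gaussian quaternion and rewrite the pair a.e.
  have hae : (fun U => (su2a0 U, su2axis U)) ∘ gaussUnit =ᵐ[stdGaussian R4]
      (fun p : ℝ × (sphere (0 : E3) 1 × ℝ) => (p.1 / Real.sqrt (p.1 ^ 2 + p.2.2 ^ 2), p.2.1)) ∘
        (Prod.map id (fun y : E3 => (dirSphere y, ‖y‖))) ∘ splitR4 := by
    have hmem : {(0 : R4)}ᶜ ∈ ae (stdGaussian R4) := compl_mem_ae_iff.2 stdGaussian_singleton_zero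
    filter_upwards [hmem] with x hx
    exact a0_axis_gaussUnit hx
  -- Step 2: the product structure
  have hprod : (Literature.MathematicalPhysics.QuantumFieldTheory.haarProbability (Matrix.specialUnitaryGroup (Fin 2) ℂ)).map (fun U => (su2a0 U, su2axis U)) =
      (((gaussianReal 0 1).prod ((stdGaussian E3).map fun y : E3 => ‖y‖)).map
        (fun q : ℝ × ℝ => q.1 / Real.sqrt (q.1 ^ 2 + q.2 ^ 2))).prod (uniformSphere (volume : Measure E3)) := by
    rw [← map_gaussUnit_stdGaussian, Measure.map_map measurable_a0_axis measurable_gaussUnit,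
      Measure.map_congr hae, ← Measure.map_map hH (hT.comp measurable_splitR4),
      ← Measure.map_map hT measurable_splitR4, stdGaussian_map_splitR4,
      ← Measure.map_prod_map _ _ measurable_id measurable_dirSphere_norm,
      Measure.map_id, stdGaussian_map_dirSphere_norm (Fin 3)]
    exact map_assemble_eq_prod _ _ _ hg
  -- Step 3: identify the first factor through the known `a₀` marginal
  have hfst : ((gaussianReal 0 1).prod ((stdGaussian E3).map fun y : E3 => ‖y‖)).map
      (fun q : ℝ × ℝ => q.1 / Real.sqrt (q.1 ^ 2 + q.2 ^ 2)) = semicircleLaw := by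
    have h1 := congrArg Measure.fst hprod
    rw [Measure.fst_map_prodMk measurable_su2axis, map_su2a0_haarProbability, Measure.fst_prod] at h1
    exact h1.symm
  rw [hprod, hfst]

/-- Densities that factor through the first coordinate of a pair pass through the push-forward. -/
theorem map_withDensity_comp_fst {α β γ : Type*} [MeasurableSpace α] [MeasurableSpace β]
    [MeasurableSpace γ] (μ : Measure α) {f : α → β} {g : α → γ} (hf : Measurable f) (hg : Measurable g)
    {w : β → ℝ≥0∞} (hw : Measurable w) :
    (μ.withDensity fun a => w (f a)).map (fun a => (f a, g a)) =
      (μ.map fun a => (f a, g a)).withDensity fun p => w p.1 := by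
  have hw1 : Measurable fun p : β × γ => w p.1 := hw.comp measurable_fst
  ext s hs
  rw [Measure.map_apply (hf.prodMk hg) hs, withDensity_apply _ (hf.prodMk hg hs), withDensity_apply _ hs,
    setLIntegral_map hs hw1 (hf.prodMk hg)]

/-- **The SU(2) heat-bath law.**  Under the one-link law `e^{c a₀(U)} dHaar(U)` (unnormalised; the
SU(2) heat-bath target with `c = βk`), the pair (`a₀`, axis) has law
`((2/π)√(1−t²) e^{ct} dt) ⊗ uniformSphere`: `a₀` follows A3's reference density, the axis is
uniform on `S²`, and the two are independent. -/
theorem map_a0_axis_linkLaw (c : ℝ) :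
    ((Literature.MathematicalPhysics.QuantumFieldTheory.haarProbability (Matrix.specialUnitaryGroup (Fin 2) ℂ)).withDensity (fun U => ENNReal.ofReal (Real.exp (c * su2a0 U)))).map
        (fun U => (su2a0 U, su2axis U)) =
      (volume.withDensity (fun t => ENNReal.ofReal (semicircleDensity t * Real.exp (c * t)))).prod
        (uniformSphere (volume : Measure E3)) := by
  have hw : Measurable fun t : ℝ => ENNReal.ofReal (Real.exp (c * t)) :=
    (Real.measurable_exp.comp (measurable_const.mul measurable_id)).ennreal_ofReal
  have hA3 : semicircleLaw.withDensity (fun t => ENNReal.ofReal (Real.exp (c * t))) =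
      volume.withDensity (fun t => ENNReal.ofReal (semicircleDensity t * Real.exp (c * t))) := by
    rw [semicircleLaw, ← withDensity_mul _ continuous_semicircleDensity.measurable.ennreal_ofReal hw]
    congr 1
    funext t
    simp only [Pi.mul_apply, ENNReal.ofReal_mul (semicircleDensity_nonneg t)]
  rw [map_withDensity_comp_fst _ continuous_su2a0.measurable measurable_su2axis hw, map_a0_axis_haar,
    ← prod_withDensity_left hw, hA3]

end Law

end Summit.Ventures.LatticeQCDFlow.Exactness
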